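import Literature.NumberTheory.GelbartRogawski1991.LocalDoubledUnitaryUnramifiedSplit
import Literature.NumberTheory.GelbartRogawski1991.LocalDoubledUnitarySplitParabolic

/-!
# The explicit Iwasawa decomposition `ι_v(t, 1) = p · k` of a diagonal Cartan element at a SPLIT place, with `det_Δ p` at both places

Track B ∕ K2-LIT, hLiu418 = stmt-HodgeConjecture-24832, LOCAL SEAM of s23, file #27 «`Λ_{s,v}` on the Cartan representatives» (K2Liu-plan (g1)
PIN `PIN-28s-Orientation` §1). Helper (count-neutral), in the GR91 local frame of ★ `LocalDoubledUnitaryDatum`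
(`H(F_v) = U(T₀ ⊕ −T₀)(F_v)`, `P_Δ` = ★ `IsSiegelDelta`, `K_H = ★ localInt`, `det_Δ` = ★ `detDelta`) at a place `v` of `F` SPLIT in `E` (`w`, `c w ≠ w`),
`T₀ ∈ GL_n(𝓞_w)`:

for `h ∈ H(F_v)` whose `w`-component is `reindex e₂ (diag(a) ⊕ 1)` (the shape of `ι_v(t, 1)_w` for a diagonal `t`, ★ `coe_iotaVLocPi_apply`),
`a_j ≠ 0`, there are EXPLICIT `p ∈ P_Δ(F_v)`, `k ∈ K_{H,v}` with `h = p · k`, `det_Δ(p_w) = ∏_{|a_j|_w ≤ 1} a_j` and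
`c_*(det_Δ(p_{c⁻¹w})) = (∏_{|a_j|_w > 1} a_j)⁻¹` (`exists_isSiegelDelta_mul_localInt_of_diagonal`). Per coordinate (tree's `(𝕍, −𝕍)` = `(inl, inr)` blocks;
`a = a_j`): `|a| ≤ 1`: `p = (0, a; −1, a+1)`, `k = (a+1, −1; 1, 0)`; `|a| > 1`: `p = (a, 1−a; 0, 1)`, `k = (1, 1−a⁻¹; 0, 1)`. With ★ D7c `lambdaLoc_mul_eq`
this evaluates the unramified section `Λ_{s,v}(ι_v(t,1))` in closed form (file #27 proper, `K2LiuUnramifiedSectionOnCartan`).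

Everything proved (★ `splitEquivD`, ★ `isSiegelDelta_of_blkC_matW_eq_zero`, ★ `splitEquivD_symm_mem_localInt_iff`, ★ `detDelta_eq_det_blkA`,
★ `map_detDelta_galInv_mul_det_blkD`); no `def`, no `sorry`. HONEST LABEL: HC_CM is proved only modulo the printed citations (2 remaining named inputs:
hLiu418 = stmt-HodgeConjecture-24832, h413 = stmt-HodgeConjecture-24833) until rung 0 closes; this file is unconditional and moves no counter.
References: [Li1992, §3 Thm. 3.1]; [GelbartPiatetskishapiroRallis1987, Part A §6]; [Liu2011, §2C (2-4) p. 863]; [Kudla1994, §3]; [HarrisKudlaSweet1996, §1 (1.15)];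
[GelbartRogawski1991, §3.1 p. 456].
-/

set_option autoImplicit false

set_option linter.dupNamespace false

noncomputable section

open NumberField IsDedekindDomain Matrix

namespace Summit.HodgeConjecture.HodgeConjecture.Cruxes.HLiu418.K2LiuSplitCartanIwasawa

open Literature.NumberTheory.Automorphic Literature.NumberTheory.Automorphic.UnitaryGroup
open Literature.NumberTheory.Automorphic.IntegralReduction
open Literature.NumberTheory.GelbartRogawski1991.AdaptedBlocks
open Literature.NumberTheory.GelbartRogawski1991.UnitaryDualPair.LocalSplitting

variable (F : Type) [Field F] [NumberField F] (E : Type) [Field E] [NumberField E] [Algebra F E]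
  [Algebra.IsQuadraticExtension F E] (c : E ≃ₐ[F] E)
  {δ : E} (hcδ : c δ = -δ) (hδ : δ ≠ 0) {d : F} (hd : δ * δ = algebraMap F E d)
  (v : HeightOneSpectrum (𝓞 F)) (n : ℕ) {T₀ : Matrix (Fin n) (Fin n) F} (hT₀ : T₀.IsSymm) (hT₀d : IsUnit T₀.det)
  {JD : Matrix (Fin (n + n)) (Fin (n + n)) E} (hJD : JD = (gramD F n T₀).map (algebraMap F E))
  (w : PlacesOver E v) (hw : c • w.1 ≠ w.1)
  (hTw : ∀ i j, ValuativeRel.valuation (w.1.adicCompletion E) (gramW F E v n (T₀ := T₀) w i j) ≤ 1)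
  (hTwd : ValuativeRel.valuation (w.1.adicCompletion E) (gramW F E v n (T₀ := T₀) w).det = 1)

/-! ## §1 Block matrices with diagonal blocks, re-enumerated by `e₂` -/

section Blocks

variable {R : Type} [CommRing R]

omit [NumberField F] [NumberField E] [Algebra.IsQuadraticExtension F E] in
/-- products of re-enumerated `2 × 2` block matrices with DIAGONAL blocks are computed coordinatewise. [cite: Kudla1994, §3] -/
theorem reindex_fromBlocks_diagonal_mul (x₁₁ x₁₂ x₂₁ x₂₂ y₁₁ y₁₂ y₂₁ y₂₂ : Fin n → R) :
    Matrix.reindex (e₂ n) (e₂ n) (Matrix.fromBlocks (diagonal x₁₁) (diagonal x₁₂) (diagonal x₂₁) (diagonal x₂₂)) *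
        Matrix.reindex (e₂ n) (e₂ n) (Matrix.fromBlocks (diagonal y₁₁) (diagonal y₁₂) (diagonal y₂₁) (diagonal y₂₂)) =
      Matrix.reindex (e₂ n) (e₂ n) (Matrix.fromBlocks (diagonal (x₁₁ * y₁₁ + x₁₂ * y₂₁)) (diagonal (x₁₁ * y₁₂ + x₁₂ * y₂₂))
        (diagonal (x₂₁ * y₁₁ + x₂₂ * y₂₁)) (diagonal (x₂₁ * y₁₂ + x₂₂ * y₂₂))) := by
  rw [Matrix.reindex_apply, Matrix.reindex_apply, Matrix.reindex_apply, Matrix.submatrix_mul_equiv, Matrix.fromBlocks_multiply]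
  simp only [diagonal_mul_diagonal, diagonal_add]
  rfl

omit [NumberField F] [NumberField E] [Algebra.IsQuadraticExtension F E] in
/-- the re-enumerated block matrix `(1, 0; 0, 1)` with diagonal blocks is `1`. [cite: Kudla1994, §3] -/
theorem reindex_fromBlocks_diagonal_eq_one {x₁₁ x₁₂ x₂₁ x₂₂ : Fin n → R} (h₁₁ : x₁₁ = fun _ => 1) (h₁₂ : x₁₂ = fun _ => 0)
    (h₂₁ : x₂₁ = fun _ => 0) (h₂₂ : x₂₂ = fun _ => 1) :
    Matrix.reindex (e₂ n) (e₂ n) (Matrix.fromBlocks (diagonal x₁₁) (diagonal x₁₂) (diagonal x₂₁) (diagonal x₂₂)) = 1 := by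
  subst h₁₁ h₁₂ h₂₁ h₂₂
  rw [diagonal_one, diagonal_zero, Matrix.fromBlocks_one, Matrix.reindex_apply, Matrix.submatrix_one_equiv]

omit [NumberField F] [NumberField E] [Algebra.IsQuadraticExtension F E] [CommRing R] in
/-- `reindex⁻¹ ∘ reindex = id` on block matrices. [cite: Kudla1994, §3] -/
theorem reindex_symm_reindex {S : Type} (M : Matrix (Fin n ⊕ Fin n) (Fin n ⊕ Fin n) S) :
    Matrix.reindex (e₂ n).symm (e₂ n).symm (Matrix.reindex (e₂ n) (e₂ n) M) = M := by
  rw [Matrix.reindex_apply, Matrix.reindex_apply, Matrix.submatrix_submatrix, Equiv.symm_symm, Equiv.symm_comp_self,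
    Matrix.submatrix_id_id]

end Blocks

omit [NumberField F] [Algebra.IsQuadraticExtension F E] in
/-- the entries of a diagonal matrix with integral diagonal are integral. [cite: PlatonovRapinchuk1994, §5.1] -/
theorem valuation_diagonal_apply_le {x : Fin n → w.1.adicCompletion E}
    (hx : ∀ j, ValuativeRel.valuation (w.1.adicCompletion E) (x j) ≤ 1) (i j : Fin n) :
    ValuativeRel.valuation (w.1.adicCompletion E) (diagonal x i j) ≤ 1 := by
  by_cases hij : i = j
  · subst hij; rw [diagonal_apply_eq]; exact hx i
  · rw [diagonal_apply_ne _ hij, Valuation.map_zero]; exact zero_le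

omit [NumberField F] [Algebra.IsQuadraticExtension F E] in
/-- a re-enumerated block matrix with diagonal blocks of integral entries is integral. [cite: PlatonovRapinchuk1994, §5.1] -/
theorem valBound_reindex_fromBlocks_diagonal {x₁₁ x₁₂ x₂₁ x₂₂ : Fin n → w.1.adicCompletion E}
    (h₁₁ : ∀ j, ValuativeRel.valuation (w.1.adicCompletion E) (x₁₁ j) ≤ 1)
    (h₁₂ : ∀ j, ValuativeRel.valuation (w.1.adicCompletion E) (x₁₂ j) ≤ 1)
    (h₂₁ : ∀ j, ValuativeRel.valuation (w.1.adicCompletion E) (x₂₁ j) ≤ 1)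
    (h₂₂ : ∀ j, ValuativeRel.valuation (w.1.adicCompletion E) (x₂₂ j) ≤ 1) :
    ValBound 1 (Matrix.reindex (e₂ n) (e₂ n) (Matrix.fromBlocks (diagonal x₁₁) (diagonal x₁₂) (diagonal x₂₁) (diagonal x₂₂))) := by
  refine valBound_reindex F E v n w ?_
  rintro (i | i) (j | j)
  · rw [Matrix.fromBlocks_apply₁₁]; exact valuation_diagonal_apply_le F E v n w h₁₁ i j
  · rw [Matrix.fromBlocks_apply₁₂]; exact valuation_diagonal_apply_le F E v n w h₁₂ i j
  · rw [Matrix.fromBlocks_apply₂₁]; exact valuation_diagonal_apply_le F E v n w h₂₁ i j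
  · rw [Matrix.fromBlocks_apply₂₂]; exact valuation_diagonal_apply_le F E v n w h₂₂ i j

/-! ## §2 The explicit `p` and `k` -/

include hT₀d hw hTw hTwd in
/-- **explicit Iwasawa decomposition of a diagonal Cartan element at a split place, with `det_Δ` at both places.**  For `h ∈ H(F_v)` with
`h_w = reindex e₂ (diag(a) ⊕ 1)`, `a_j ≠ 0`: `h = p · k` with `p ∈ P_Δ(F_v)`, `k ∈ K_{H,v}`, `det_Δ(p_w) = ∏_{|a_j| ≤ 1} a_j` and
`c_*(det_Δ(p_{c⁻¹ w})) = (∏_{|a_j| > 1} a_j)⁻¹`. [cite: Li1992, §3 Thm. 3.1] [cite: GelbartPiatetskishapiroRallis1987, Part A §6] [cite: Kudla1994, §3] -/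
theorem exists_isSiegelDelta_mul_localInt_of_diagonal (a : Fin n → w.1.adicCompletion E) (ha : ∀ j, a j ≠ 0)
    (h : UnitaryGroup.localPi E c (n + n) JD v)
    (hh : (((h : UnitaryGroup.LocalGLPi E (n + n) v) w : GL (Fin (n + n)) (w.1.adicCompletion E)) :
        Matrix (Fin (n + n)) (Fin (n + n)) (w.1.adicCompletion E)) =
      Matrix.reindex (e₂ n) (e₂ n) (Matrix.fromBlocks (diagonal a) 0 0 1)) :
    ∃ p k : UnitaryGroup.localPi E c (n + n) JD v,
      IsSiegelDelta F E c hcδ hδ hd v n hT₀ hJD p ∧ k ∈ UnitaryGroup.localInt E c (n + n) JD v ∧ h = p * k ∧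
        detDelta F E c v n w p =
          ∏ j, (if ValuativeRel.valuation (w.1.adicCompletion E) (a j) ≤ 1 then a j else 1) ∧
        galAdicCompletionMap c (smul_inv_smul c w.1) (detDelta F E c v n (PlacesOver.galInv c w) p) =
          (∏ j, (if ValuativeRel.valuation (w.1.adicCompletion E) (a j) ≤ 1 then 1 else a j))⁻¹ := by
  -- shorthand `s j` ⇔ `|a_j|_w ≤ 1`; the blocks of `p`, `p⁻¹`, `k`, `k⁻¹` in the tree's `(inl, inr)` coordinates
  let s : Fin n → Prop := fun j => ValuativeRel.valuation (w.1.adicCompletion E) (a j) ≤ 1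
  let p₁₁ : Fin n → w.1.adicCompletion E := fun j => if s j then 0 else a j
  let p₁₂ : Fin n → w.1.adicCompletion E := fun j => if s j then a j else 1 - a j
  let p₂₁ : Fin n → w.1.adicCompletion E := fun j => if s j then -1 else 0
  let p₂₂ : Fin n → w.1.adicCompletion E := fun j => if s j then a j + 1 else 1
  let q₁₁ : Fin n → w.1.adicCompletion E := fun j => if s j then (a j + 1) * (a j)⁻¹ else (a j)⁻¹
  let q₁₂ : Fin n → w.1.adicCompletion E := fun j => if s j then -1 else -((1 - a j) * (a j)⁻¹)
  let q₂₁ : Fin n → w.1.adicCompletion E := fun j => if s j then (a j)⁻¹ else 0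
  let q₂₂ : Fin n → w.1.adicCompletion E := fun j => if s j then 0 else 1
  let k₁₁ : Fin n → w.1.adicCompletion E := fun j => if s j then a j + 1 else 1
  let k₁₂ : Fin n → w.1.adicCompletion E := fun j => if s j then -1 else 1 - (a j)⁻¹
  let k₂₁ : Fin n → w.1.adicCompletion E := fun j => if s j then 1 else 0
  let k₂₂ : Fin n → w.1.adicCompletion E := fun j => if s j then 0 else 1
  let l₁₁ : Fin n → w.1.adicCompletion E := fun j => if s j then 0 else 1
  let l₁₂ : Fin n → w.1.adicCompletion E := fun j => if s j then 1 else -(1 - (a j)⁻¹)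
  let l₂₁ : Fin n → w.1.adicCompletion E := fun j => if s j then -1 else 0
  let l₂₂ : Fin n → w.1.adicCompletion E := fun j => if s j then a j + 1 else 1
  let Pm : Matrix (Fin (n + n)) (Fin (n + n)) (w.1.adicCompletion E) :=
    Matrix.reindex (e₂ n) (e₂ n) (Matrix.fromBlocks (diagonal p₁₁) (diagonal p₁₂) (diagonal p₂₁) (diagonal p₂₂))
  let Qm : Matrix (Fin (n + n)) (Fin (n + n)) (w.1.adicCompletion E) :=
    Matrix.reindex (e₂ n) (e₂ n) (Matrix.fromBlocks (diagonal q₁₁) (diagonal q₁₂) (diagonal q₂₁) (diagonal q₂₂))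
  let Km : Matrix (Fin (n + n)) (Fin (n + n)) (w.1.adicCompletion E) :=
    Matrix.reindex (e₂ n) (e₂ n) (Matrix.fromBlocks (diagonal k₁₁) (diagonal k₁₂) (diagonal k₂₁) (diagonal k₂₂))
  let Lm : Matrix (Fin (n + n)) (Fin (n + n)) (w.1.adicCompletion E) :=
    Matrix.reindex (e₂ n) (e₂ n) (Matrix.fromBlocks (diagonal l₁₁) (diagonal l₁₂) (diagonal l₂₁) (diagonal l₂₂))
  -- `P · P⁻¹ = 1`, `K · K⁻¹ = 1`, `P · K = diag(a) ⊕ 1`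
  have hPQ : Pm * Qm = 1 := by
    simp only [Pm, Qm, reindex_fromBlocks_diagonal_mul]
    refine reindex_fromBlocks_diagonal_eq_one n ?_ ?_ ?_ ?_ <;> funext j <;>
      simp only [Pi.add_apply, Pi.mul_apply, p₁₁, p₁₂, p₂₁, p₂₂, q₁₁, q₁₂, q₂₁, q₂₂] <;> split_ifs <;> field_simp [ha j] <;> ring
  have hKL : Km * Lm = 1 := by
    simp only [Km, Lm, reindex_fromBlocks_diagonal_mul]
    refine reindex_fromBlocks_diagonal_eq_one n ?_ ?_ ?_ ?_ <;> funext j <;>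
      simp only [Pi.add_apply, Pi.mul_apply, k₁₁, k₁₂, k₂₁, k₂₂, l₁₁, l₁₂, l₂₁, l₂₂] <;> split_ifs <;> ring
  have hPK : Pm * Km = Matrix.reindex (e₂ n) (e₂ n) (Matrix.fromBlocks (diagonal a) 0 0 1) := by
    simp only [Pm, Km, reindex_fromBlocks_diagonal_mul]
    have e11 : p₁₁ * k₁₁ + p₁₂ * k₂₁ = a := by
      funext j; simp only [Pi.add_apply, Pi.mul_apply, p₁₁, p₁₂, k₁₁, k₂₁]; split_ifs <;> ring
    have e12 : p₁₁ * k₁₂ + p₁₂ * k₂₂ = fun _ => 0 := by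
      funext j; simp only [Pi.add_apply, Pi.mul_apply, p₁₁, p₁₂, k₁₂, k₂₂]; split_ifs <;> field_simp [ha j] <;> ring
    have e21 : p₂₁ * k₁₁ + p₂₂ * k₂₁ = fun _ => 0 := by
      funext j; simp only [Pi.add_apply, Pi.mul_apply, p₂₁, p₂₂, k₁₁, k₂₁]; split_ifs <;> ring
    have e22 : p₂₁ * k₁₂ + p₂₂ * k₂₂ = fun _ => 1 := by
      funext j; simp only [Pi.add_apply, Pi.mul_apply, p₂₁, p₂₂, k₁₂, k₂₂]; split_ifs <;> ring
    rw [e11, e12, e21, e22, diagonal_zero, diagonal_one]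
  -- the `GL` elements and the unitary elements
  let Pgl : GL (Fin (n + n)) (w.1.adicCompletion E) := ⟨Pm, Qm, hPQ, mul_eq_one_comm.1 hPQ⟩
  let Kgl : GL (Fin (n + n)) (w.1.adicCompletion E) := ⟨Km, Lm, hKL, mul_eq_one_comm.1 hKL⟩
  have hhw : ((h : UnitaryGroup.LocalGLPi E (n + n) v) w) = Pgl * Kgl := Units.ext (by rw [hh, Units.val_mul]; exact hPK.symm)
  let eD := splitEquivD F E c hcδ hδ v n hT₀ hT₀d hJD w hw
  have hmatW : matW F E c v n w (eD.symm Pgl) = Matrix.fromBlocks (diagonal p₁₁) (diagonal p₁₂) (diagonal p₂₁) (diagonal p₂₂) := by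
    simp only [matW, eD, splitEquivD_symm_apply_w]
    exact reindex_symm_reindex n _
  have hC : blkC (matW F E c v n w (eD.symm Pgl)) = 0 := by
    rw [hmatW, blkC_eq_zero_iff]
    simp only [Matrix.toBlocks_fromBlocks₁₁, Matrix.toBlocks_fromBlocks₁₂, Matrix.toBlocks_fromBlocks₂₁, Matrix.toBlocks_fromBlocks₂₂,
      diagonal_add]
    congr 1; funext j; simp only [p₁₁, p₁₂, p₂₁, p₂₂]; split_ifs <;> ring
  have hp : IsSiegelDelta F E c hcδ hδ hd v n hT₀ hJD (eD.symm Pgl) := isSiegelDelta_of_blkC_matW_eq_zero F E c hcδ hδ hd v n hT₀ hT₀d hJD w hw hC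
  refine ⟨eD.symm Pgl, eD.symm Kgl, hp, ?_, ?_, ?_, ?_⟩
  · -- `k ∈ K_{H,v}`: integral entries of `k_w` and `k_w⁻¹`
    refine (splitEquivD_symm_mem_localInt_iff F E c hcδ hδ v n hT₀ hT₀d hJD w hw hTw hTwd Kgl).2
      (mem_glInt_of_valBound F E v n w ?_ ?_)
    · refine valBound_reindex_fromBlocks_diagonal F E v n w ?_ ?_ ?_ ?_ <;> intro j <;> simp only [k₁₁, k₁₂, k₂₁, k₂₂] <;> split_ifs with hj
      · exact Valuation.map_add_le _ hj (by rw [Valuation.map_one])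
      · rw [Valuation.map_one]
      · rw [Valuation.map_neg, Valuation.map_one]
      · refine Valuation.map_sub_le _ (by rw [Valuation.map_one]) ?_
        rw [map_inv₀, inv_le_one₀ ((Valuation.pos_iff _).2 (ha j))]; exact (not_le.1 hj).le
      · rw [Valuation.map_one]
      · rw [Valuation.map_zero]; exact zero_le
      · rw [Valuation.map_zero]; exact zero_le
      · rw [Valuation.map_one]
    · show ValBound 1 Lm
      refine valBound_reindex_fromBlocks_diagonal F E v n w ?_ ?_ ?_ ?_ <;> intro j <;> simp only [l₁₁, l₁₂, l₂₁, l₂₂] <;> split_ifs with hj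
      · rw [Valuation.map_zero]; exact zero_le
      · rw [Valuation.map_one]
      · rw [Valuation.map_one]
      · rw [Valuation.map_neg]
        refine Valuation.map_sub_le _ (by rw [Valuation.map_one]) ?_
        rw [map_inv₀, inv_le_one₀ ((Valuation.pos_iff _).2 (ha j))]; exact (not_le.1 hj).le
      · rw [Valuation.map_neg, Valuation.map_one]
      · rw [Valuation.map_zero]; exact zero_le
      · exact Valuation.map_add_le _ hj (by rw [Valuation.map_one])
      · rw [Valuation.map_one]
  · -- `h = p k`
    rw [← map_mul, ← hhw, ← splitEquivD_apply F E c hcδ hδ v n hT₀ hT₀d hJD w hw h]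
    exact (ContinuousMulEquiv.symm_apply_apply _ _).symm
  · -- `det_Δ(p_w) = det A(p_w)`
    rw [detDelta_eq_det_blkA F E c hcδ hδ hd v n hT₀ hJD hp w, blkA_eq_of_blkC_eq_zero hC, hmatW]
    simp only [Matrix.toBlocks_fromBlocks₁₁, Matrix.toBlocks_fromBlocks₁₂, diagonal_add, det_diagonal]
    refine Finset.prod_congr rfl fun j _ => ?_
    simp only [p₁₁, p₁₂]; split_ifs <;> ring
  · -- `c_*(det_Δ(p_{c⁻¹w})) · det D(p_w) = 1`
    have h1 := map_detDelta_galInv_mul_det_blkD F E c hcδ hδ hd v n hT₀ hT₀d hJD hp w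
    have hD : (blkD (matW F E c v n w (eD.symm Pgl))).det =
        ∏ j, (if ValuativeRel.valuation (w.1.adicCompletion E) (a j) ≤ 1 then 1 else a j) := by
      rw [hmatW, blkD]
      simp only [Matrix.toBlocks_fromBlocks₁₁, Matrix.toBlocks_fromBlocks₁₂, Matrix.toBlocks_fromBlocks₂₁, Matrix.toBlocks_fromBlocks₂₂,
        diagonal_add, diagonal_sub, ← diagonal_smul, det_diagonal]
      refine Finset.prod_congr rfl fun j _ => ?_
      simp only [Pi.smul_apply, smul_eq_mul, p₁₁, p₁₂, p₂₁, p₂₂, invOf_eq_inv]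
      split_ifs <;> ring
    rw [hD] at h1
    exact eq_inv_of_mul_eq_one_left h1

end Summit.HodgeConjecture.HodgeConjecture.Cruxes.HLiu418.K2LiuSplitCartanIwasawa

end
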